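import Summits.QuantumFields.BalabanUV.Beta.GAN24.Capacitance
import Summits.QuantumFields.BalabanUV.Beta.GAN24.CombesThomasFibre

/-!
# `BalabanUV.Beta.GAN24.FibInvClosedForm` — binder row G-an2-4 / (CONV-C), road P1-fibre, leaf **P1-L05b** (part 1/2) of gan24-p1's `SKELETON-P1`
# leaf table: the inverse-fibre ENTRY FUNCTIONS `fibInv N i j` of `GAN24/CombesThomasFibre` at REAL quasi-momentum ARE the bordered-inverse
# closed form of `GAN24/Capacitance` — for the leg indices that the step resolvent reads (field legs `inl (κ,z)`, multiplier legs `inr (inr κ)`)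

NOT IN PRINT; OUR PROOF ATTEMPT.  HONEST FRAMING (cell contract, verbatim): «discharging `BetaPertH` makes Bałaban's UV stability UNCONDITIONAL — a real
constructive-QFT result; it is NOT the continuum limit and NOT the Clay problem.»  HONEST DEPENDENCY (verbatim): «continuum YM on T⁴ ⇐ BetaPertH ∧ nine spine
estimates (0/9 proved); BetaPertH ⇐ (D1) ∧ (D4) ∧ CAP+tail; G-an2-4 gates asym, D1 and NE2/3/4.»  [folklore] finite-dimensional linear algebra over `ℂ`: an
IDENTIFICATION (no estimate, no cited fact, no wall binder, no `def … : Prop` fact).  NOT summit progress; nothing of (CONV-C)'s K-slot is discharged here.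

## What is proved (generic `d`, block side `N ≥ 1`, REAL quasi-momentum `p = ofRealVec q`, alias data `F = FibreArrow.aliasFibre p hL` with `hL : ∀ m, L_m ≠ 0`)
§1 `capSolves_inv`: for ANY fibre data with invertible capacitance matrix, `(φ; c) := (capMat F)⁻¹ *ᵥ capRhs F f γ ρ q` solves leaf-15's capacitance system
   (`Capacitance.capSolves_iff_mulVec` read backwards) — the «`Cap⁻¹` applied to the sources» step of S1b′.
§2 `fibInv_eq_inv_apply`, `fibreFun_fibInvCol`: the column `i ↦ fibInv N i j p` of `GAN24/CombesThomasFibre` IS the `j`-th column of `(fibreMatrix (blochChar p))⁻¹`,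
   i.e. the solution of the fibre system with the unit right-hand side `Pi.single j 1` (an2's `det_fibreMatrix_blochChar_ne_zero'`).
§3 sources of the unit columns (explicit, by `FibreDFT.amp`): a FIELD source at `(l, z′)` has EL-source `[κ = l]·N^{−D}·pw(−k_m)(repZ z′)` and no G/M/Q source
   (`srcEL_single_inl`, `srcG_single_inl`, …); a MULTIPLIER source `inr (inr l)` has only the Q-source `Pi.single l 1` (`srcEL_single_inr`, …).
§4 **THE CLOSED FORM OF THE INVERSE-FIBRE ENTRIES** (leaf-06's `Capacitance.bordered_inverse` on the unit columns): for every solution `(φ, c)` of the capacitance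
   system with the sources of §3 (it exists and is unique: `Capacitance.exists_capSolves`/`cap_unique`; §1 gives it as `capMat⁻¹ *ᵥ capRhs`),
   `fibInv N (inr (inr κ)) j p = φ κ` and `fibInv N (inl (κ, z)) j p = Σ_m Ablk F (srcEL p e_j) (srcG p e_j) φ c m κ · pw (k_m) (repZ z)`
   (`fibInv_inr_inr_eq`, `fibInv_inl_eq`), specialised to the two source types in `fibInv_inl_inl`, `fibInv_inl_inr`, `fibInv_inr_inl`, `fibInv_inr_inr`
   — S1b′ of `SKELETON-P1.md` («`fibInv = closed form`, all four leg types via `legIdx`»; executable twin `diag/kkt_fourier.py: kmat_closed`).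
Part 2/2 (`GAN24/KFibClosedForm`): the leg sums of `CombesThomasFibreStep.kFib` collapse onto these formulas (M-level reading/source weights).
Unit `b2b-balaban-gan24-formalise-leaf-05` (G-an2-4 formalisation swarm), 2026-08-20.
-/

noncomputable section

open Complex Finset
open scoped BigOperators Matrix
open Literature.MathematicalPhysics.QuantumFieldTheory.Balaban1983to89
open Literature.MathematicalPhysics.QuantumFieldTheory.Balaban1983to89.Beta
open Literature.MathematicalPhysics.QuantumFieldTheory.LatticeForm (repZ)
open Literature.Probability.LatticeModels (TorusSite)
open B4Strip (ofRealVec)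
open AffineAveraging (Site)
open BlochFibreMatrix (Idx blochChar fibreFun fibreMatrix fibreMatrix_mulVec fibreMatrix_blochChar_eq_trigPolySymbol det_fibreMatrix_blochChar_ne_zero'
  norm_blochChar_real)
open Summit.QuantumFields.BalabanUV.Beta.GAN24.FibreSymbols (pw lapSym)
open Summit.QuantumFields.BalabanUV.Beta.GAN24.FibreDFT (kFine amp)
open Summit.QuantumFields.BalabanUV.Beta.GAN24.CapacitanceSolve (Fibre CapSolves Ablk mublk srcQ srcM)
open Summit.QuantumFields.BalabanUV.Beta.GAN24.FibreArrow (srcEL rG srcG aliasFibre)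
open Summit.QuantumFields.BalabanUV.Beta.GAN24.Capacitance (capMat capVec capRhs capSolves_iff_mulVec capVec_eta isUnit_capMat bordered_inverse
  exists_capSolves cap_unique amp_zero')
open Summit.QuantumFields.BalabanUV.Beta.GAN24.CombesThomasFibre (fibInv)

namespace Summit.QuantumFields.BalabanUV.Beta.GAN24.FibInvClosedForm

/-! ## §1 The capacitance solution as `capMat⁻¹ *ᵥ capRhs` -/

section CapInv

variable {D : ℕ} {ι : Type*} [Fintype ι] (F : Fibre D ι)

/-- [folklore] **`Cap⁻¹` APPLIED TO THE SOURCES SOLVES THE CAPACITANCE SYSTEM**: if `capMat F` is invertible, the vector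
`x := (capMat F)⁻¹ *ᵥ capRhs F f γ ρ q`, split as `(φ; c) = (x ∘ inl; x (inr ()))`, satisfies `CapSolves F f γ ρ q φ c`. -/
theorem capSolves_inv (hU : IsUnit (capMat F)) (f : ι → Fin D → ℂ) (γ : ι → ℂ) (ρ : ℂ) (q : Fin D → ℂ) :
    CapSolves F f γ ρ q (fun κ => ((capMat F)⁻¹.mulVec (capRhs F f γ ρ q)) (Sum.inl κ))
      (((capMat F)⁻¹.mulVec (capRhs F f γ ρ q)) (Sum.inr ())) := by
  rw [capSolves_iff_mulVec, capVec_eta, Matrix.mulVec_mulVec,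
    Matrix.mul_nonsing_inv _ ((Matrix.isUnit_iff_isUnit_det _).mp hU), Matrix.one_mulVec]

end CapInv

/-! ## §2 The inverse-fibre entry functions are the columns of the inverse fibre matrix -/

section Column

variable {d N : ℕ} [NeZero N]

/-- [folklore] `fibInv N i j p = ((fibreMatrix (blochChar p))⁻¹) i j` for every complex `p` (an2's `fibreMatrix_blochChar_eq_trigPolySymbol`). -/
theorem fibInv_eq_inv_apply (p : Fin (d + 1) → ℂ) (i j : Idx (d + 1) N) :
    fibInv N i j p = (fibreMatrix (N := N) (⇑(blochChar p)))⁻¹ i j := by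
  unfold fibInv
  rw [fibreMatrix_blochChar_eq_trigPolySymbol]

/-- [folklore] The column `i ↦ fibInv N i j p` is `(fibreMatrix (blochChar p))⁻¹ *ᵥ Pi.single j 1`. -/
theorem fibInvCol_eq_mulVec_single (p : Fin (d + 1) → ℂ) (j : Idx (d + 1) N) :
    (fun i => fibInv N i j p) = (fibreMatrix (N := N) (⇑(blochChar p)))⁻¹ *ᵥ Pi.single j 1 := by
  funext i
  rw [fibInv_eq_inv_apply, Matrix.mulVec_single_one]
  rfl

/-- [folklore] The determinant of the fibre matrix at a REAL quasi-momentum is a unit. -/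
theorem isUnit_det_fibreMatrix (q : Fin (d + 1) → ℝ) : IsUnit (fibreMatrix (N := N) (⇑(blochChar (ofRealVec q)))).det :=
  (det_fibreMatrix_blochChar_ne_zero' (N := N) (p := ofRealVec q) (fun μ => by simp [ofRealVec])).isUnit

/-- [folklore] **THE COLUMN `j` OF `fibInv` SOLVES THE FIBRE SYSTEM WITH UNIT RIGHT-HAND SIDE `e_j`** (real quasi-momentum). -/
theorem fibreFun_fibInvCol (q : Fin (d + 1) → ℝ) (j : Idx (d + 1) N) :
    fibreFun (⇑(blochChar (ofRealVec q))) (fun i => fibInv N i j (ofRealVec q)) = Pi.single j 1 := by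
  rw [← fibreMatrix_mulVec, fibInvCol_eq_mulVec_single, Matrix.mulVec_mulVec,
    Matrix.mul_nonsing_inv _ (isUnit_det_fibreMatrix q), Matrix.one_mulVec]

/-- [folklore] The Bloch character of a real quasi-momentum is unitary (an2's `norm_blochChar_real`, in `ofRealVec` dress). -/
theorem norm_blochChar_ofRealVec (q : Fin (d + 1) → ℝ) (a : Site (d + 1)) : ‖blochChar (ofRealVec q) a‖ = 1 :=
  norm_blochChar_real q a

end Column

/-! ## §3 The sources of the unit columns -/

section Sources

variable {d N : ℕ} [NeZero N]

/-- [folklore] The twisted box DFT of a box delta: `amp p (Pi.single z′ 1) m = N^{−(d+1)}·pw(−k_m)(repZ z′)`. -/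
theorem amp_single (p : Fin (d + 1) → ℂ) (z' m : TorusSite (d + 1) N) :
    amp p (Pi.single z' (1 : ℂ)) m = (((N : ℂ) ^ (d + 1))⁻¹) * pw (-kFine p m) (repZ z') := by
  unfold amp
  congr 1
  rw [Finset.sum_eq_single z']
  · simp
  · intro b _ hb; simp [hb]
  · intro h; exact absurd (Finset.mem_univ z') h

/-- [folklore] EL-source of a FIELD unit column `e_{inl (l, z′)}`: `[κ = l]·N^{−(d+1)}·pw(−k_m)(repZ z′)`. -/
theorem srcEL_single_inl (p : Fin (d + 1) → ℂ) (l : Fin (d + 1)) (z' : TorusSite (d + 1) N) (m : TorusSite (d + 1) N) (κ : Fin (d + 1)) :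
    srcEL p (Pi.single (Sum.inl (l, z')) (1 : ℂ)) m κ
      = if κ = l then (((N : ℂ) ^ (d + 1))⁻¹) * pw (-kFine p m) (repZ z') else 0 := by
  unfold srcEL
  by_cases h : κ = l
  · subst h
    rw [if_pos rfl, ← amp_single p z' m]
    congr 1
    funext z
    by_cases hz : z = z'
    · subst hz; simp
    · rw [Pi.single_apply, Pi.single_apply, if_neg hz, if_neg]
      intro hh; exact hz (by simpa using hh)
  · rw [if_neg h]
    have : (fun z => Pi.single (M := fun _ : Idx (d + 1) N => ℂ) (Sum.inl (l, z')) (1 : ℂ) (Sum.inl (κ, z))) = 0 := by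
      funext z
      rw [Pi.single_apply, if_neg]
      · rfl
      · intro hh
        simp only [Sum.inl.injEq, Prod.mk.injEq] at hh
        exact h hh.1
    rw [this]
    exact amp_zero' p m

/-- [folklore] G-source of a field unit column: zero. -/
theorem srcG_single_inl (p : Fin (d + 1) → ℂ) (l : Fin (d + 1)) (z' : TorusSite (d + 1) N) :
    srcG p (Pi.single (Sum.inl (l, z')) (1 : ℂ)) = 0 := by
  funext m
  unfold srcG
  have : rG (Pi.single (M := fun _ : Idx (d + 1) N => ℂ) (Sum.inl (l, z')) (1 : ℂ)) = (0 : TorusSite (d + 1) N → ℂ) := by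
    funext z; unfold rG; split_ifs <;> simp
  rw [this]
  exact amp_zero' p m

omit [NeZero N] in
/-- [folklore] M-slot of a field unit column: zero. -/
theorem single_inl_M (l : Fin (d + 1)) (z' : TorusSite (d + 1) N) :
    Pi.single (M := fun _ : Idx (d + 1) N => ℂ) (Sum.inl (l, z')) (1 : ℂ) (Sum.inr (Sum.inl 0)) = 0 := by
  simp

omit [NeZero N] in
/-- [folklore] Q-slots of a field unit column: zero. -/
theorem single_inl_Q (l : Fin (d + 1)) (z' : TorusSite (d + 1) N) (κ : Fin (d + 1)) :
    Pi.single (M := fun _ : Idx (d + 1) N => ℂ) (Sum.inl (l, z')) (1 : ℂ) (Sum.inr (Sum.inr κ)) = 0 := by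
  simp

/-- [folklore] EL-source of a MULTIPLIER unit column `e_{inr (inr l)}`: zero. -/
theorem srcEL_single_inr (p : Fin (d + 1) → ℂ) (l : Fin (d + 1)) :
    srcEL p (Pi.single (M := fun _ : Idx (d + 1) N => ℂ) (Sum.inr (Sum.inr l)) (1 : ℂ)) = 0 := by
  funext m κ
  unfold srcEL
  have : (fun z : TorusSite (d + 1) N => Pi.single (M := fun _ : Idx (d + 1) N => ℂ) (Sum.inr (Sum.inr l)) (1 : ℂ) (Sum.inl (κ, z))) = 0 := by
    funext z; simp
  rw [this]
  exact amp_zero' p m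

/-- [folklore] G-source of a multiplier unit column: zero. -/
theorem srcG_single_inr (p : Fin (d + 1) → ℂ) (l : Fin (d + 1)) :
    srcG p (Pi.single (M := fun _ : Idx (d + 1) N => ℂ) (Sum.inr (Sum.inr l)) (1 : ℂ)) = 0 := by
  funext m
  unfold srcG
  have : rG (Pi.single (M := fun _ : Idx (d + 1) N => ℂ) (Sum.inr (Sum.inr l)) (1 : ℂ)) = (0 : TorusSite (d + 1) N → ℂ) := by
    funext z; unfold rG; split_ifs <;> simp
  rw [this]
  exact amp_zero' p m

omit [NeZero N] in
/-- [folklore] M-slot of a multiplier unit column: zero. -/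
theorem single_inr_M (l : Fin (d + 1)) :
    Pi.single (M := fun _ : Idx (d + 1) N => ℂ) (Sum.inr (Sum.inr l)) (1 : ℂ) (Sum.inr (Sum.inl 0)) = 0 := by
  simp

omit [NeZero N] in
/-- [folklore] Q-slots of a multiplier unit column: the unit vector `e_l`. -/
theorem single_inr_Q (l κ : Fin (d + 1)) :
    Pi.single (M := fun _ : Idx (d + 1) N => ℂ) (Sum.inr (Sum.inr l)) (1 : ℂ) (Sum.inr (Sum.inr κ)) = if κ = l then 1 else 0 := by
  simp [Pi.single_apply]

end Sources

/-! ## §4 The closed form of the inverse-fibre entries at real quasi-momentum -/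

section ClosedForm

variable {d N : ℕ} [NeZero N]

/-- [folklore] **MULTIPLIER ROW OF THE INVERSE**: for real `p = ofRealVec q`, `hL`, any column `j` and ANY solution `(φ, c)` of the capacitance system with the
sources of `e_j`: `fibInv N (inr (inr κ)) j p = φ κ`. -/
theorem fibInv_inr_inr_eq (q : Fin (d + 1) → ℝ) (hL : ∀ m : TorusSite (d + 1) N, lapSym (kFine (ofRealVec q) m) ≠ 0) (j : Idx (d + 1) N)
    {φ : Fin (d + 1) → ℂ} {c : ℂ}
    (hcap : CapSolves (aliasFibre (ofRealVec q) hL) (srcEL (ofRealVec q) (Pi.single j (1 : ℂ))) (srcG (ofRealVec q) (Pi.single j (1 : ℂ)))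
      (Pi.single (M := fun _ : Idx (d + 1) N => ℂ) j (1 : ℂ) (Sum.inr (Sum.inl 0)))
      (fun κ => Pi.single (M := fun _ : Idx (d + 1) N => ℂ) j (1 : ℂ) (Sum.inr (Sum.inr κ))) φ c)
    (κ : Fin (d + 1)) : fibInv N (Sum.inr (Sum.inr κ)) j (ofRealVec q) = φ κ :=
  (bordered_inverse (ofRealVec q) (norm_blochChar_ofRealVec q) hL (fibreFun_fibInvCol q j) hcap).1 κ

/-- [folklore] **FIELD ROW OF THE INVERSE**: for real `p = ofRealVec q`, `hL`, any column `j` and ANY solution `(φ, c)` of the capacitance system with the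
sources of `e_j`: `fibInv N (inl (κ, z)) j p = Σ_m Ablk F (srcEL p e_j) (srcG p e_j) φ c m κ · pw k_m (repZ z)` — the synthesis of leaf-15's per-alias formula. -/
theorem fibInv_inl_eq (q : Fin (d + 1) → ℝ) (hL : ∀ m : TorusSite (d + 1) N, lapSym (kFine (ofRealVec q) m) ≠ 0) (j : Idx (d + 1) N)
    {φ : Fin (d + 1) → ℂ} {c : ℂ}
    (hcap : CapSolves (aliasFibre (ofRealVec q) hL) (srcEL (ofRealVec q) (Pi.single j (1 : ℂ))) (srcG (ofRealVec q) (Pi.single j (1 : ℂ)))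
      (Pi.single (M := fun _ : Idx (d + 1) N => ℂ) j (1 : ℂ) (Sum.inr (Sum.inl 0)))
      (fun κ => Pi.single (M := fun _ : Idx (d + 1) N => ℂ) j (1 : ℂ) (Sum.inr (Sum.inr κ))) φ c)
    (κ : Fin (d + 1)) (z : TorusSite (d + 1) N) :
    fibInv N (Sum.inl (κ, z)) j (ofRealVec q)
      = ∑ m : TorusSite (d + 1) N, Ablk (aliasFibre (ofRealVec q) hL) (srcEL (ofRealVec q) (Pi.single j (1 : ℂ)))
          (srcG (ofRealVec q) (Pi.single j (1 : ℂ))) φ c m κ * pw (kFine (ofRealVec q) m) (repZ z) :=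
  (bordered_inverse (ofRealVec q) (norm_blochChar_ofRealVec q) hL (fibreFun_fibInvCol q j) hcap).2.1 κ z

/-- [folklore] The EL-source family of a FIELD source at `(l, z′)` as a named function of the alias (for the specialised statements). -/
def fieldSrc (p : Fin (d + 1) → ℂ) (l : Fin (d + 1)) (z' : TorusSite (d + 1) N) : TorusSite (d + 1) N → Fin (d + 1) → ℂ :=
  fun m κ => if κ = l then (((N : ℂ) ^ (d + 1))⁻¹) * pw (-kFine p m) (repZ z') else 0

/-- [folklore] `srcEL p e_{inl (l,z′)} = fieldSrc p l z′`. -/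
theorem srcEL_single_inl_eq_fieldSrc (p : Fin (d + 1) → ℂ) (l : Fin (d + 1)) (z' : TorusSite (d + 1) N) :
    srcEL p (Pi.single (M := fun _ : Idx (d + 1) N => ℂ) (Sum.inl (l, z')) (1 : ℂ)) = fieldSrc p l z' := by
  funext m κ
  exact srcEL_single_inl p l z' m κ

/-- [folklore] **FIELD–FIELD ENTRY** `(inl (κ,z), inl (l,z′))`: with `(φ, c)` solving the capacitance system with sources `(fieldSrc p l z′, 0, 0, 0)`,
`fibInv = Σ_m Ablk F (fieldSrc p l z′) 0 φ c m κ · pw k_m (repZ z)`. -/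
theorem fibInv_inl_inl (q : Fin (d + 1) → ℝ) (hL : ∀ m : TorusSite (d + 1) N, lapSym (kFine (ofRealVec q) m) ≠ 0)
    (l : Fin (d + 1)) (z' : TorusSite (d + 1) N) {φ : Fin (d + 1) → ℂ} {c : ℂ}
    (hcap : CapSolves (aliasFibre (ofRealVec q) hL) (fieldSrc (ofRealVec q) l z') 0 0 0 φ c)
    (κ : Fin (d + 1)) (z : TorusSite (d + 1) N) :
    fibInv N (Sum.inl (κ, z)) (Sum.inl (l, z')) (ofRealVec q)
      = ∑ m : TorusSite (d + 1) N, Ablk (aliasFibre (ofRealVec q) hL) (fieldSrc (ofRealVec q) l z') 0 φ c m κ * pw (kFine (ofRealVec q) m) (repZ z) := by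
  have h := fibInv_inl_eq q hL (Sum.inl (l, z')) (φ := φ) (c := c) ?_ κ z
  · rw [h, srcEL_single_inl_eq_fieldSrc, srcG_single_inl]
  · rw [srcEL_single_inl_eq_fieldSrc, srcG_single_inl, single_inl_M]
    have hQ : (fun κ => Pi.single (M := fun _ : Idx (d + 1) N => ℂ) (Sum.inl (l, z')) (1 : ℂ) (Sum.inr (Sum.inr κ))) = 0 := by
      funext κ; exact single_inl_Q l z' κ
    rw [hQ]
    exact hcap

/-- [folklore] **MULTIPLIER–FIELD ENTRY** `(inr (inr κ), inl (l,z′))`: with the same `(φ, c)`, `fibInv = φ κ`. -/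
theorem fibInv_inr_inl (q : Fin (d + 1) → ℝ) (hL : ∀ m : TorusSite (d + 1) N, lapSym (kFine (ofRealVec q) m) ≠ 0)
    (l : Fin (d + 1)) (z' : TorusSite (d + 1) N) {φ : Fin (d + 1) → ℂ} {c : ℂ}
    (hcap : CapSolves (aliasFibre (ofRealVec q) hL) (fieldSrc (ofRealVec q) l z') 0 0 0 φ c) (κ : Fin (d + 1)) :
    fibInv N (Sum.inr (Sum.inr κ)) (Sum.inl (l, z')) (ofRealVec q) = φ κ := by
  refine fibInv_inr_inr_eq q hL (Sum.inl (l, z')) (φ := φ) (c := c) ?_ κ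
  rw [srcEL_single_inl_eq_fieldSrc, srcG_single_inl, single_inl_M]
  have hQ : (fun κ => Pi.single (M := fun _ : Idx (d + 1) N => ℂ) (Sum.inl (l, z')) (1 : ℂ) (Sum.inr (Sum.inr κ))) = 0 := by
    funext κ; exact single_inl_Q l z' κ
  rw [hQ]
  exact hcap

/-- [folklore] **FIELD–MULTIPLIER ENTRY** `(inl (κ,z), inr (inr l))`: with `(φ, c)` solving the capacitance system with sources `(0, 0, 0, e_l)`,
`fibInv = Σ_m Ablk F 0 0 φ c m κ · pw k_m (repZ z)` (pure border response: no per-alias force). -/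
theorem fibInv_inl_inr (q : Fin (d + 1) → ℝ) (hL : ∀ m : TorusSite (d + 1) N, lapSym (kFine (ofRealVec q) m) ≠ 0)
    (l : Fin (d + 1)) {φ : Fin (d + 1) → ℂ} {c : ℂ}
    (hcap : CapSolves (aliasFibre (ofRealVec q) hL) 0 0 0 (fun κ => if κ = l then 1 else 0) φ c)
    (κ : Fin (d + 1)) (z : TorusSite (d + 1) N) :
    fibInv N (Sum.inl (κ, z)) (Sum.inr (Sum.inr l)) (ofRealVec q)
      = ∑ m : TorusSite (d + 1) N, Ablk (aliasFibre (ofRealVec q) hL) 0 0 φ c m κ * pw (kFine (ofRealVec q) m) (repZ z) := by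
  have h := fibInv_inl_eq q hL (Sum.inr (Sum.inr l)) (φ := φ) (c := c) ?_ κ z
  · rw [h, srcEL_single_inr, srcG_single_inr]
  · rw [srcEL_single_inr, srcG_single_inr, single_inr_M]
    have hQ : (fun κ => Pi.single (M := fun _ : Idx (d + 1) N => ℂ) (Sum.inr (Sum.inr l)) (1 : ℂ) (Sum.inr (Sum.inr κ)))
        = fun κ => if κ = l then (1 : ℂ) else 0 := by
      funext κ; exact single_inr_Q l κ
    rw [hQ]
    exact hcap

/-- [folklore] **MULTIPLIER–MULTIPLIER ENTRY** `(inr (inr κ), inr (inr l))`: with the same `(φ, c)`, `fibInv = φ κ` — the `φφ` block of `Cap⁻¹` read directly. -/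
theorem fibInv_inr_inr (q : Fin (d + 1) → ℝ) (hL : ∀ m : TorusSite (d + 1) N, lapSym (kFine (ofRealVec q) m) ≠ 0)
    (l : Fin (d + 1)) {φ : Fin (d + 1) → ℂ} {c : ℂ}
    (hcap : CapSolves (aliasFibre (ofRealVec q) hL) 0 0 0 (fun κ => if κ = l then 1 else 0) φ c) (κ : Fin (d + 1)) :
    fibInv N (Sum.inr (Sum.inr κ)) (Sum.inr (Sum.inr l)) (ofRealVec q) = φ κ := by
  refine fibInv_inr_inr_eq q hL (Sum.inr (Sum.inr l)) (φ := φ) (c := c) ?_ κ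
  rw [srcEL_single_inr, srcG_single_inr, single_inr_M]
  have hQ : (fun κ => Pi.single (M := fun _ : Idx (d + 1) N => ℂ) (Sum.inr (Sum.inr l)) (1 : ℂ) (Sum.inr (Sum.inr κ)))
      = fun κ => if κ = l then (1 : ℂ) else 0 := by
    funext κ; exact single_inr_Q l κ
  rw [hQ]
  exact hcap

/-- [folklore] EXISTENCE of the capacitance solution for the field sources (so the hypotheses `hcap` above are never vacuous), with `Cap⁻¹` explicit. -/
theorem capSolves_fieldSrc (q : Fin (d + 1) → ℝ) (hL : ∀ m : TorusSite (d + 1) N, lapSym (kFine (ofRealVec q) m) ≠ 0)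
    (l : Fin (d + 1)) (z' : TorusSite (d + 1) N) :
    CapSolves (aliasFibre (ofRealVec q) hL) (fieldSrc (ofRealVec q) l z') 0 0 0
      (fun κ => ((capMat (aliasFibre (ofRealVec q) hL))⁻¹.mulVec (capRhs (aliasFibre (ofRealVec q) hL) (fieldSrc (ofRealVec q) l z') 0 0 0)) (Sum.inl κ))
      (((capMat (aliasFibre (ofRealVec q) hL))⁻¹.mulVec (capRhs (aliasFibre (ofRealVec q) hL) (fieldSrc (ofRealVec q) l z') 0 0 0)) (Sum.inr ())) :=
  capSolves_inv _ (isUnit_capMat (ofRealVec q) (norm_blochChar_ofRealVec q) hL) _ _ _ _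

/-- [folklore] EXISTENCE of the capacitance solution for the multiplier sources, with `Cap⁻¹` explicit. -/
theorem capSolves_multSrc (q : Fin (d + 1) → ℝ) (hL : ∀ m : TorusSite (d + 1) N, lapSym (kFine (ofRealVec q) m) ≠ 0) (l : Fin (d + 1)) :
    CapSolves (aliasFibre (ofRealVec q) hL) 0 0 0 (fun κ => if κ = l then 1 else 0)
      (fun κ => ((capMat (aliasFibre (ofRealVec q) hL))⁻¹.mulVec (capRhs (aliasFibre (ofRealVec q) hL) 0 0 0 (fun κ => if κ = l then 1 else 0))) (Sum.inl κ))
      (((capMat (aliasFibre (ofRealVec q) hL))⁻¹.mulVec (capRhs (aliasFibre (ofRealVec q) hL) 0 0 0 (fun κ => if κ = l then 1 else 0))) (Sum.inr ())) :=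
  capSolves_inv _ (isUnit_capMat (ofRealVec q) (norm_blochChar_ofRealVec q) hL) _ _ _ _

end ClosedForm

end Summit.QuantumFields.BalabanUV.Beta.GAN24.FibInvClosedForm

end
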